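import Literature.NumberTheory.Automorphic.AnisotropicSmoothTraceExpansion               -- ★ «SSG-H1» (F0-typ3 (g8)): `AnisotropicSmoothTraceExpansion L N H μ ν hanis` (row #2 letter, Literature side)
import Summits.HodgeConjecture.HodgeConjecture.Theorems.F0P3KitOfRecord                 -- ★ K0: `kitOfRecord` (`traceGp := 𝔰.traceGp`, `trGp := trGp₀ (Gp L H) μ ν`, `tens := tens₀`, `Cls∕mult` of record)
import Summits.HodgeConjecture.HodgeConjecture.Theorems.F0P3ClassificationLawsV8        -- ★ V8-B (p03): law `SpectralSideGp` (unguarded at v8)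
import HarnessLib

/-!
# Crux `H413` — T5 ED. 4, row #2: GLUE «SSG» ⟹ law `SpectralSideGp` AT THE KIT OF RECORD (H2 glue of the Literature letter ★ `AnisotropicSmoothTraceExpansion`)

F0∕P3 «U3-mult», cell `hodgecm-mathlib`, crux H413 (`stmt-HodgeConjecture-24833`); pen F0P3-p02 (g7) (F0-typ3 (g8) 13:46:32Z∕13:50:07Z «cc p02 (g7)∕pool (the H2 glue pen)»;
junction = typ3's cert `F0/P3/typ3/CERT-SSG-junction.bypaste.F0-typ3g8.lean`, re-proved here over the ★ letter).  PROOF lane (`--kind proof --supports stmt-HodgeConjecture-24833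
--as helper`): theorems only; no `def`, no instance, no notation, no named fact asserted, no `sorry`.

THE LAW (★ V8-B `ClassificationKit.SpectralSideGp`, :73–:76, unguarded): `∀ S fS fT, Summable (c ↦ mult c · trGp c (tens S fS fT)) ∧ traceGp (tens S fS fT) = Σ' c, mult c · trGp c (tens S fS fT)`
[Rogawski1990 §14.5 p. 237 «`T_{G′}(f′) = Σ_{π′} m(π′) tr π′(f′)`»; Gelbart1975 (10.14)].  At `𝔠₀ = kitOfRecord 𝔰 …`: `traceGp := 𝔰.traceGp` (T1's socket), `trGp := trGp₀ (Gp L H) μ ν`,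
`tens := tens₀`, `Cls∕mult` ★ p819048 (read-backs `rfl`).
THE LETTER (★ «SSG»): for smooth pure tensors `F` (T1's `Smooth`: `∃ T : PureTensor, T.IsTest ∧ ⇑F = T.eval`), clause (2) gives `HasSum (c ↦ m(rp c) · Σ'_k ⟪b c k, R(F) b c k⟫) (θ_{G′} F)`
for every classifying map `q`, section `rp`, bases `b`, with `θ_{G′} = UnitaryGroup.diagTrace L N H μ ν hanis`.
THE GLUE: at `q := cl`, `rp := rep`, `b := clsBasis` (★ `F0P3SpectralSideOfRecord`) the summand IS `mult c · trGp₀ ν c F` by `rfl`, `range cl = univ` (★ `cl_surjective`) re-indexes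
to `Cls`, `F := tens₀ S fS fT` is smooth (★ `tens₀_smooth`), and T1's pin (v) «`traceGp = θ_{G′}`» is the hypothesis `htr` on the socket (a `Sockets.ofT1` read-back at K9).
* `summable_and_diagTrace_eq_tsum_cls` — «SSG» re-indexed over the classes of record (generic `N`, smooth `F`).
* **`spectralSideGp_kitOfRecord (hanis) (hSSG) (htr) : (kitOfRecord …).SpectralSideGp`** — row #2 at 𝔠₀ (K7 ED. 4∕K9β: `h2' := spectralSideGp_kitOfRecord …`).
HONEST LABEL: HC_CM is proved only modulo the printed citations until rung 0 closes; «SSG» is a letter (k = 1, or 0 after the Dixmier–Malliavin pay-down); this file adds none.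
-/

set_option autoImplicit false
-- the mandated namespace has the single-problem summit's repeated segment (`HodgeConjecture.HodgeConjecture`)
set_option linter.dupNamespace false

noncomputable section
namespace Summit.HodgeConjecture.HodgeConjecture.Cruxes.H413.F0P3LettersSpectralSideGp

open NumberField IsDedekindDomain MeasureTheory CompactlySupported
open scoped InnerProductSpace Matrix
open Literature.NumberTheory.Rogawski1990 Literature.NumberTheory.GaloisRepresentations
open Literature.NumberTheory.Automorphic Literature.NumberTheory.Automorphic.UnitaryGroup
open Literature.NumberTheory.Automorphic.UnitaryGroup.CotangentForms
open Summit.HodgeConjecture.HodgeConjecture.Cruxes.H413.F0P3InnerFormClassificationV6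
open Summit.HodgeConjecture.HodgeConjecture.Cruxes.H413.F0P3ClassTokensOfRecord (Cls cl rep mult cl_eq_cl_iff cl_rep cl_surjective)
open Summit.HodgeConjecture.HodgeConjecture.Cruxes.H413.F0P3SpectralSideOfRecord (clsBasisIdx clsBasis trGp₀)
open Summit.HodgeConjecture.HodgeConjecture.Cruxes.H413.F0P3SemilocalTestFunctionsOfRecord (TestS₀ tens₀ tens₀_smooth)
open Summit.HodgeConjecture.HodgeConjecture.Cruxes.H413.F0P3TestFunctionsOfRecord (Unr₀)
open Summit.HodgeConjecture.HodgeConjecture.Cruxes.H413.F0P3KitOfRecord (kitOfRecord GHSide XiSide)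

/-! ## §1 «SSG» re-indexed over the classes of record -/

section Junction

variable {L : Type} [Field L] [NumberField L] [IsCMField L] {N : ℕ} {H : Matrix (Fin N) (Fin N) L}
  [MeasurableSpace (cmDatum L N H).Adelic] [BorelSpace (cmDatum L N H).Adelic]
  {μ : Measure (cmDatum L N H).automorphicQuotient} [(cmDatum L N H).IsAutomorphicMeasure μ]
  {ν : Measure (cmDatum L N H).Adelic} [ν.IsHaarMeasure]

/-- **«SSG» over the classes of record**: for a smooth pure tensor `F`, `Σ_c mult c · trGp₀ ν c F` converges absolutely to `θ_{G′}(F)` — clause (2) of ★ `AnisotropicSmoothTraceExpansion`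
at `Λ := Cls`, `q := cl` (★ `cl_eq_cl_iff`), `rp := rep` (★ `cl_rep`), `b := clsBasis`, re-indexed along `range cl = univ` (★ `cl_surjective`); the summand is `mult c · trGp₀ ν c F` by `rfl`.
[cite: Rogawski1990, §14.5 p. 237] [cite: Gelbart1975, §9.A.2 (9.7)–(9.12)] -/
theorem summable_and_diagTrace_eq_tsum_cls {hanis : ∀ x : Fin N → L, Literature.AlgebraicGeometry.ShimuraVarieties.hermForm (cmConjRingHom L) H x x = 0 → x = 0}
    (h : AnisotropicSmoothTraceExpansion L N H μ ν hanis)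
    (F : C_c((cmDatum L N H).Adelic, ℂ)) (hF : ∃ T : PureTensor L N H, T.IsTest ∧ ⇑F = T.eval) :
    Summable (fun c : Cls (cmDatum L N H) μ => (mult (cmDatum L N H) μ c : ℂ) * trGp₀ (cmDatum L N H) μ ν c F) ∧
      UnitaryGroup.diagTrace L N H μ ν hanis F = ∑' c : Cls (cmDatum L N H) μ, (mult (cmDatum L N H) μ c : ℂ) * trGp₀ (cmDatum L N H) μ ν c F := by
  -- clause (2) at the tokens of record
  obtain ⟨-, -, h2⟩ := h F hF
  have hsum := h2 (Λ := Cls (cmDatum L N H) μ) (cl (cmDatum L N H) μ) (cl_eq_cl_iff (cmDatum L N H) μ)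
    (fun c => rep (cmDatum L N H) μ c.1) (fun c => cl_rep (cmDatum L N H) μ c.1)
    (κ := fun c => ↥(clsBasisIdx (cmDatum L N H) μ c.1)) (fun c => clsBasis (cmDatum L N H) μ c.1)
  have hrange : Set.range (cl (cmDatum L N H) μ) = Set.univ := Set.range_eq_univ.2 (cl_surjective (cmDatum L N H) μ)
  let e : Set.range (cl (cmDatum L N H) μ) ≃ Cls (cmDatum L N H) μ := (Equiv.setCongr hrange).trans (Equiv.Set.univ _)
  have hs' : HasSum (fun c : Cls (cmDatum L N H) μ => (mult (cmDatum L N H) μ c : ℂ) * trGp₀ (cmDatum L N H) μ ν c F)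
      (UnitaryGroup.diagTrace L N H μ ν hanis F) := by
    rw [← e.hasSum_iff]
    exact hsum.congr_fun fun c => rfl
  exact ⟨hs'.summable, hs'.tsum_eq.symm⟩

end Junction

/-! ## §2 Row #2 at the kit of record -/

section Frame

variable (L : Type) [Field L] [NumberField L] [IsCMField L] (H : Matrix (Fin 3) (Fin 3) L) (ι : L →+* ℂ) (T : GL (Fin 3) ℂ)
  (hT : (T : Matrix (Fin 3) (Fin 3) ℂ)ᴴ * H.map ι * (T : Matrix (Fin 3) (Fin 3) ℂ) = Literature.Geometry.ComplexHyperbolic.BallModel.J)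
  (μ : Measure (Gp L H).automorphicQuotient) [iA : (Gp L H).IsAutomorphicMeasure μ]
  [iM : MeasurableSpace (Gp L H).Adelic] [iB : BorelSpace (Gp L H).Adelic]

set_option maxHeartbeats 400000 in
/-- **LAW `SpectralSideGp` (row #2) AT `𝔠₀`, FROM «SSG» AND T1's PIN (v)**: if `H` is anisotropic (`hanis`; in the letters' frame ★ `anisotropic_of_frame L H ι hdef h2`), «SSG» holds for
`(μ, ν)` and the socket's trace functional IS the diagonal trace `θ_{G′}` (`htr : ∀ F, 𝔰.traceGp F = diagTrace … F` — T1's pin (v) `𝔨.traceGp = UnitaryGroup.diagTrace L 3 H μ ν hanis`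
read back through `socketsOfT1`∕`override_traceGp` at K9, F0P3-plan (g6) 13:56:48Z (1)(i)), then
`(kitOfRecord 𝔰 …).SpectralSideGp`: `F := tens₀ S fS fT` is a smooth pure tensor (★ `tens₀_smooth`), and §1 gives both conjuncts (`traceGp := 𝔰.traceGp`, `trGp := trGp₀ (Gp L H) μ ν`,
`tens := tens₀`, `mult` of record — all `rfl`).  FRAME NOTE: the letter is typed over `cmDatum L 3 H`, the kit over `Gp L H := UnitaryGroup.adelicGroupData L⁺ L c̄ 3 H` — the two data
are definitionally equal field by field (★ `UnitaryGroup.adelic_complexConj`, `rational_complexConj`: `Iff.rfl`) but neither is reducible, so the measurable ∕ automorphic ∕ Haar instances of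
the kit's frame (`iM iB iA hν`, named binders) are handed to the letter EXPLICITLY (`@AnisotropicSmoothTraceExpansion L _ _ _ 3 H iM iB μ iA ν hν hanis`); a consumer in the kit's
frame writes `hSSG`∕`htr` with the same spelling.
[cite: Rogawski1990, §14.5 p. 237] [cite: Gelbart1975, §9.A.2 (9.7)–(9.12)] -/
theorem spectralSideGp_kitOfRecord (𝔰 : Sockets L H μ) (gh : GHSide L H ι T hT 𝔰.PacketG 𝔰.PacketH) (ξd : XiSide L H 𝔰.PacketG 𝔰.PacketH)
    (μω : HeckeCharacter L) (c : ℚ) (jInf dsInf : ℤ → ℤ → ℤ → Cinf)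
    (archTr : Cinf → (UnitaryGroup.arch (↥(maximalRealSubfield L)) L (IsCMField.complexConj L) 3 H → ℂ) → ℂ)
    (ν : Measure (Gp L H).Adelic) [hν : ν.IsHaarMeasure]
    (μv : ∀ v : Places L, @Measure ((cmDatum L 3 H).Local v) (borel _))
    (ramCls₀ : DiscreteAutomorphicRep (Gp L H) μ → Set (Places L))
    (hanis : ∀ x : Fin 3 → L, Literature.AlgebraicGeometry.ShimuraVarieties.hermForm (cmConjRingHom L) H x x = 0 → x = 0)
    (hSSG : @AnisotropicSmoothTraceExpansion L _ _ _ 3 H iM iB μ iA ν hν hanis)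
    (htr : ∀ F : TestGp L H, 𝔰.traceGp F = @UnitaryGroup.diagTrace L _ _ _ 3 H iM iB μ iA ν hν hanis F) :
    F0P3InnerFormClassificationV8.ClassificationKit.SpectralSideGp (kitOfRecord L H ι T hT μ 𝔰 gh ξd μω c jInf dsInf archTr ν μv ramCls₀) := by
  -- the kit's frame instances, re-read on `cmDatum L 3 H` (definitionally the same data)
  letI i₁ : MeasurableSpace (cmDatum L 3 H).Adelic := iM
  letI i₂ : BorelSpace (cmDatum L 3 H).Adelic := iB
  letI i₃ : (cmDatum L 3 H).IsAutomorphicMeasure μ := iA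
  letI i₄ : @Measure.IsHaarMeasure (cmDatum L 3 H).Adelic _ _ i₁ ν := hν
  intro S fS fT
  obtain ⟨hs, heq⟩ := summable_and_diagTrace_eq_tsum_cls (L := L) (N := 3) (H := H) (μ := μ) (ν := ν) hSSG (tens₀ S fS fT) (tens₀_smooth S fS fT)
  exact ⟨hs, (htr (tens₀ S fS fT)).trans heq⟩

end Frame

end Summit.HodgeConjecture.HodgeConjecture.Cruxes.H413.F0P3LettersSpectralSideGp
end
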